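import Summits.Ventures.PercRepro.RankDistMinorBottom

/-!
# PercRepro — the cumulative shadow inequality under deletion and contraction (p9, gen 18)

THE REDUCTION. Let `M` have rank `p + 1` and let `e` be free at `q + 1` (`FreeAt M (q+1) e` of
`RankDistMinorBottom`: a non-loop lying in no cocircuit of rank `≤ q + 1` after its removal). Then every
rank-`u` set through `e` that contains a bottom set of `(p+1, q+1)` contains one THROUGH `e`
(`exists_bottom_mem_of_subset`, by a basis exchange inside `B ∪ e`), so the upper shadow of the bottom family
splits at every level, `s_{v+1}(M) = s_{v+1}(M ∖ e) + s_v(M / e)` (`card_shadowLev_eq_delete_add_contract`;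
the `M / e` side carries the bottom sets of `(p, q)`), and the cumulative shadow inequality is INHERITED:
**`shadowCumulative_of_delete_contract`** — `ShadowCumulative (M ∖ e) (p+1) (q+1)` and
`ShadowCumulative (M / e) p q` give `ShadowCumulative M (p+1) (q+1)`, because the binomial ratio
`C(N, u)/C(N, q+1)` is at most `C(N−2, u−1)/C(N−2, q)` (`choose_mul_choose_le_choose_mul_choose`, `N = p+q+2`).

So the candidate conjecture (SC) of `RankDistCumulative` — and with it C-025 at `(p, q)` through
`rls_of_shadowCumulative` — is reduced to the matroids in which EVERY element lies in a cocircuit `C*` with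
`ρ(C* ∖ e) ≤ q` (the uniform matroid `U_{p,p+q}`, where (SC) is an equality, is such a matroid: every
`(q+1)`-set is a cocircuit). Nothing here is a statement about any window of the crux.
-/

namespace PercRepro.RankDist

open Set Finset Matroid PercRepro.ThmH

variable {α : Type} [DecidableEq α] (M : Matroid α) [M.Finite]

/-- **Exchange.** Under `FreeAt M (q+1) e` and `eRank M = p+1`: a set `Y ∋ e` containing a bottom set of
`(p+1, q+1)` contains a bottom set THROUGH `e`. -/
lemma exists_bottom_mem_of_subset {p q : ℕ} {e : α} (h : FreeAt M (q + 1) e)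
    (hr : M.eRank = (p + 1 : ℕ)) {Y : Set α} (heY : e ∈ Y) {B : Finset α}
    (hB : B ∈ PerFlat.Uq M (p + 1) (q + 1)) (hBY : (B : Set α) ⊆ Y) :
    ∃ B' ∈ PerFlat.Uq M (p + 1) (q + 1), e ∈ B' ∧ (B' : Set α) ⊆ Y := by
  by_cases heB : e ∈ B
  · exact ⟨B, hB, heB, hBY⟩
  have heE : e ∈ M.E := h.1.mem_ground
  rw [PerFlat.mem_Uq] at hB
  obtain ⟨hBg, hBq, hBp⟩ := hB
  have hBE : (B : Set α) ⊆ M.E \ {e} := by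
    intro x hx
    refine ⟨?_, fun hh => heB (by rw [mem_singleton_iff] at hh; rw [← hh]; exact hx)⟩
    rw [← coe_gr]; exact_mod_cast hBg hx
  have hcomp : M.eRk (M.E \ insert e (B : Set α)) = (p + 1 : ℕ) := by
    rw [h.eRk_diff_eq M hBE hBq.le]; rwa [Finset.coe_sdiff, coe_gr] at hBp
  -- any `B'` with `e ∈ B' ⊆ B ∪ e` of rank `q + 1` is a bottom set
  have key : ∀ B' : Finset α, (B' : Set α) ⊆ insert e (B : Set α) →
      M.eRk (B' : Set α) = (q + 1 : ℕ) → B' ∈ PerFlat.Uq M (p + 1) (q + 1) := by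
    intro B' hB'sub hB'q
    rw [PerFlat.mem_Uq]
    refine ⟨?_, hB'q, ?_⟩
    · intro x hx
      rw [← Finset.mem_coe, coe_gr]
      exact (insert_subset heE (hBE.trans Set.sdiff_subset)) (hB'sub hx)
    · rw [Finset.coe_sdiff, coe_gr]
      apply le_antisymm
      · rw [← hr]; exact M.eRk_le_eRank _
      · rw [← hcomp]; exact M.eRk_mono (Set.sdiff_subset_sdiff_right hB'sub)
  rcases eq_or_ne (M.eRk (insert e (B : Set α))) (q + 1 : ℕ) with hq1 | hq2
  · refine ⟨insert e B, key _ (by rw [Finset.coe_insert]) (by rw [Finset.coe_insert]; exact hq1),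
      Finset.mem_insert_self e B, ?_⟩
    rw [Finset.coe_insert]; exact insert_subset heY hBY
  · -- `e ∉ cl B`: drop one element of a basis of `B` and add `e`
    have heJ : e ∉ M.closure (B : Set α) := by
      intro hcl
      exact hq2 (by rw [eRk_insert_eq_of_mem_closure M hcl, hBq])
    obtain ⟨J, hJ⟩ := M.exists_isBasis (B : Set α) (hBE.trans Set.sdiff_subset)
    have hJcard : J.encard = (q + 1 : ℕ) := by rw [← hJ.eRk_eq_encard, hBq]
    have hJne : J.Nonempty := by
      rw [← Set.encard_pos, hJcard]; exact_mod_cast Nat.succ_pos q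
    obtain ⟨b, hb⟩ := hJne
    have hJ'indep : M.Indep (J \ {b}) := hJ.indep.subset Set.sdiff_subset
    have hJ'card : (J \ {b}).encard + 1 = (q + 1 : ℕ) := by
      rw [encard_sdiff_singleton_add_one hb, hJcard]
    have heJ' : e ∉ M.closure (J \ {b}) := fun hh =>
      heJ (M.closure_mono (Set.sdiff_subset.trans hJ.subset) hh)
    have hrank : M.eRk (insert e (J \ {b})) = (q + 1 : ℕ) := by
      rw [Matroid.eRk_insert_eq_add_one ⟨heE, heJ'⟩, hJ'indep.eRk_eq_encard, hJ'card]
    have hfin : (insert e (J \ {b})).Finite :=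
      (B.finite_toSet.subset (Set.sdiff_subset.trans hJ.subset)).insert e
    refine ⟨hfin.toFinset, key _ ?_ ?_, ?_, ?_⟩
    · rw [hfin.coe_toFinset]
      exact insert_subset_insert (Set.sdiff_subset.trans hJ.subset)
    · rw [hfin.coe_toFinset]; exact hrank
    · rw [hfin.mem_toFinset]; exact mem_insert e _
    · rw [hfin.coe_toFinset]
      exact insert_subset heY ((Set.sdiff_subset.trans hJ.subset).trans hBY)

open scoped Classical in
/-- The members of the shadow avoiding `e` form the shadow of `M ∖ e` (under `FreeAt M q e`). -/
lemma shadowLev_filter_notMem_eq {p q u : ℕ} {e : α} (h : FreeAt M q e) :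
    (shadowLev M u (PerFlat.Uq M p q)).filter (fun A => e ∉ A)
      = shadowLev (M.delete {e}) u (PerFlat.Uq (M.delete {e}) p q) := by
  ext A
  rw [Finset.mem_filter, mem_shadowLev, mem_shadowLev, Matroid.delete_ground]
  constructor
  · rintro ⟨⟨hAE, hAu, B, hB, hBA⟩, heA⟩
    have hAE' : A ⊆ M.E \ {e} := Set.subset_sdiff.2 ⟨hAE, Set.disjoint_singleton_right.2 heA⟩
    refine ⟨hAE', ?_, B, (mem_Uq_delete_iff M h).2 ⟨hB, fun hh => heA (hBA hh)⟩, hBA⟩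
    have hAE'' : A ⊆ (M.delete {e}).E := by rw [Matroid.delete_ground]; exact hAE'
    rw [rk_eq_iff (M.delete {e}) hAE'', deleteElem_eRk_eq M hAE', ← rk_eq_iff M hAE]
    exact hAu
  · rintro ⟨hAE', hAu, B, hB, hBA⟩
    have heA : e ∉ A := fun hh => (hAE' hh).2 rfl
    have hAE : A ⊆ M.E := hAE'.trans Set.sdiff_subset
    refine ⟨⟨hAE, ?_, B, ((mem_Uq_delete_iff M h).1 hB).1, hBA⟩, heA⟩
    have hAE'' : A ⊆ (M.delete {e}).E := by rw [Matroid.delete_ground]; exact hAE'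
    rw [rk_eq_iff (M.delete {e}) hAE'', deleteElem_eRk_eq M hAE', ← rk_eq_iff M hAE] at hAu
    exact hAu

open scoped Classical in
/-- The members of the shadow through `e`, with `e` removed, form the shadow of `M / e` one level down
(under `FreeAt M (q+1) e`, `eRank M = p+1`). -/
lemma card_shadowLev_filter_mem_eq {p q v : ℕ} {e : α} (h : FreeAt M (q + 1) e)
    (hr : M.eRank = (p + 1 : ℕ)) :
    ((shadowLev M (v + 1) (PerFlat.Uq M (p + 1) (q + 1))).filter (fun A => e ∈ A)).card
      = (shadowLev (M.contract {e}) v (PerFlat.Uq (M.contract {e}) p q)).card := by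
  have heE : e ∈ M.E := h.1.mem_ground
  apply Finset.card_bij (fun A _ => A \ {e})
  · intro A hA
    rw [Finset.mem_filter, mem_shadowLev] at hA
    obtain ⟨⟨hAE, hAu, B, hB, hBA⟩, heA⟩ := hA
    rw [mem_shadowLev, Matroid.contract_ground]
    have hAE' : A \ {e} ⊆ M.E \ {e} := Set.sdiff_subset_sdiff_left hAE
    refine ⟨hAE', ?_, ?_⟩
    · have hAE'' : A \ {e} ⊆ (M.contract {e}).E := by rw [Matroid.contract_ground]; exact hAE'
      rw [rk_eq_iff (M.contract {e}) hAE'']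
      have h1 := contractElem_eRk_add_one M h.1 hAE'
      rw [Set.insert_sdiff_singleton, insert_eq_of_mem heA] at h1
      rw [rk_eq_iff M hAE] at hAu
      rw [hAu] at h1
      exact WithTop.add_right_cancel ENat.one_ne_top (h1.trans (Nat.cast_succ v))
    · obtain ⟨B', hB', heB', hB'A⟩ := exists_bottom_mem_of_subset M h hr heA hB hBA
      refine ⟨B'.erase e, ?_, ?_⟩
      · rw [mem_Uq_contract_iff M h, Finset.insert_erase heB']
        exact ⟨hB', Finset.notMem_erase e B'⟩
      · rw [Finset.coe_erase]; exact Set.sdiff_subset_sdiff_left hB'A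
  · intro A hA A' hA' hAA'
    rw [Finset.mem_filter] at hA hA'
    rw [← insert_eq_of_mem hA.2, ← insert_eq_of_mem hA'.2, ← Set.insert_sdiff_singleton,
      ← Set.insert_sdiff_singleton (s := A'), hAA']
  · intro A'' hA''
    rw [mem_shadowLev, Matroid.contract_ground] at hA''
    obtain ⟨hA''E, hA''v, B'', hB'', hB''A⟩ := hA''
    have heA'' : e ∉ A'' := fun hh => (hA''E hh).2 rfl
    refine ⟨insert e A'', ?_, ?_⟩
    · rw [Finset.mem_filter, mem_shadowLev]
      refine ⟨⟨insert_subset heE (hA''E.trans Set.sdiff_subset), ?_, insert e B'',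
        ((mem_Uq_contract_iff M h).1 hB'').1, ?_⟩, mem_insert e A''⟩
      · rw [rk_eq_iff M (insert_subset heE (hA''E.trans Set.sdiff_subset))]
        have h1 := contractElem_eRk_add_one M h.1 hA''E
        have hA''E' : A'' ⊆ (M.contract {e}).E := by rw [Matroid.contract_ground]; exact hA''E
        rw [rk_eq_iff (M.contract {e}) hA''E'] at hA''v
        rw [hA''v] at h1
        rw [← h1]; push_cast; rfl
      · rw [Finset.coe_insert]; exact insert_subset_insert hB''A
    · rw [Set.insert_sdiff_of_mem _ (mem_singleton e), sdiff_singleton_eq_self heA'']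

open scoped Classical in
/-- **The shadow splits under deletion and contraction**: for a free element `e` and `eRank M = p + 1`,
`s_{v+1}(M) = s_{v+1}(M ∖ e) + s_v(M / e)` (bottom sets of `(p+1, q+1)` on the left and in `M ∖ e`, of
`(p, q)` in `M / e`). -/
theorem card_shadowLev_eq_delete_add_contract {p q v : ℕ} {e : α} (h : FreeAt M (q + 1) e)
    (hr : M.eRank = (p + 1 : ℕ)) :
    (shadowLev M (v + 1) (PerFlat.Uq M (p + 1) (q + 1))).card
      = (shadowLev (M.delete {e}) (v + 1) (PerFlat.Uq (M.delete {e}) (p + 1) (q + 1))).card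
        + (shadowLev (M.contract {e}) v (PerFlat.Uq (M.contract {e}) p q)).card := by
  have key := Finset.card_filter_add_card_filter_not (fun A => e ∈ A)
    (s := shadowLev M (v + 1) (PerFlat.Uq M (p + 1) (q + 1)))
  rw [← shadowLev_filter_notMem_eq M h, ← card_shadowLev_filter_mem_eq M h hr, ← key, Nat.add_comm]

/-- `(i+1)(m+1−i)·C(m+2, i+1) = (m+2)(m+1)·C(m, i)`. -/
lemma choose_two_step_identity (m i : ℕ) :
    (i + 1) * (m + 1 - i) * (m + 2).choose (i + 1) = (m + 2) * (m + 1) * m.choose i := by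
  have e1 := Nat.add_one_mul_choose_eq (m + 1) i
  have e2 := Nat.choose_succ_right_eq (m + 1) i
  have e3 := Nat.add_one_mul_choose_eq m i
  calc (i + 1) * (m + 1 - i) * (m + 2).choose (i + 1)
      = (m + 1 - i) * ((m + 1 + 1).choose (i + 1) * (i + 1)) := by ring
    _ = (m + 1 - i) * ((m + 1 + 1) * (m + 1).choose i) := by rw [e1]
    _ = (m + 2) * ((m + 1).choose i * (m + 1 - i)) := by ring
    _ = (m + 2) * ((m + 1).choose (i + 1) * (i + 1)) := by rw [e2]
    _ = (m + 2) * ((m + 1) * m.choose i) := by rw [e3]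
    _ = (m + 2) * (m + 1) * m.choose i := by ring

/-- The binomial ratio `C(m+2, b+1)/C(m+2, a+1)` is at most `C(m, b)/C(m, a)` for `a ≤ b`, `a + b ≤ m`. -/
lemma choose_mul_choose_le_choose_mul_choose {m a b : ℕ} (hab : a ≤ b) (hm : a + b ≤ m) :
    (m + 2).choose (b + 1) * m.choose a ≤ (m + 2).choose (a + 1) * m.choose b := by
  have ha := choose_two_step_identity m a
  have hb := choose_two_step_identity m b
  have hpos : 0 < (b + 1) * (m + 1 - b) * ((a + 1) * (m + 1 - a)) := by
    apply Nat.mul_pos <;> apply Nat.mul_pos <;> omega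
  apply Nat.le_of_mul_le_mul_left _ hpos
  have hfac : (a + 1) * (m + 1 - a) ≤ (b + 1) * (m + 1 - b) := by
    obtain ⟨d, rfl⟩ : ∃ d, b = a + d := ⟨b - a, by omega⟩
    obtain ⟨c, hc⟩ : ∃ c, m + 1 - (a + d) = c := ⟨_, rfl⟩
    have hc' : m + 1 - a = c + d := by omega
    rw [hc, hc']
    have : a + 1 ≤ c := by omega
    nlinarith
  calc (b + 1) * (m + 1 - b) * ((a + 1) * (m + 1 - a)) * ((m + 2).choose (b + 1) * m.choose a)
      = ((b + 1) * (m + 1 - b) * (m + 2).choose (b + 1)) * ((a + 1) * (m + 1 - a)) * m.choose a := by ring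
    _ = ((m + 2) * (m + 1) * m.choose b) * ((a + 1) * (m + 1 - a)) * m.choose a := by rw [hb]
    _ ≤ ((m + 2) * (m + 1) * m.choose b) * ((b + 1) * (m + 1 - b)) * m.choose a := by
        gcongr
    _ = ((m + 2) * (m + 1) * m.choose a) * ((b + 1) * (m + 1 - b)) * m.choose b := by ring
    _ = ((a + 1) * (m + 1 - a) * (m + 2).choose (a + 1)) * ((b + 1) * (m + 1 - b)) * m.choose b := by
        rw [ha]
    _ = (b + 1) * (m + 1 - b) * ((a + 1) * (m + 1 - a)) * ((m + 2).choose (a + 1) * m.choose b) := by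
        ring

/-- **THE CUMULATIVE SHADOW INEQUALITY IS INHERITED FROM `M ∖ e` AND `M / e`** for a free element `e`:
if `ShadowCumulative (M ∖ e) (p+1) (q+1)` and `ShadowCumulative (M / e) p q`, then
`ShadowCumulative M (p+1) (q+1)` (for `eRank M = p + 1`). -/
theorem shadowCumulative_of_delete_contract {p q : ℕ} {e : α} (h : FreeAt M (q + 1) e)
    (hr : M.eRank = (p + 1 : ℕ))
    (hD : ShadowCumulative (M.delete {e}) (p + 1) (q + 1))
    (hC : ShadowCumulative (M.contract {e}) p q) : ShadowCumulative M (p + 1) (q + 1) := by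
  intro u hqu hup
  obtain ⟨v, rfl⟩ : ∃ v, u = v + 1 := ⟨u - 1, by omega⟩
  -- the split at level `q + 1` and at level `v + 1`
  rw [card_shadowLev_eq_delete_add_contract M h hr (v := q),
    card_shadowLev_eq_delete_add_contract M h hr (v := v)]
  have h1 := hD (v + 1) hqu hup
  have h2 := hC v (by omega) (by omega)
  set N := p + 1 + (q + 1) with hN
  set sD0 := (shadowLev (M.delete {e}) (q + 1) (PerFlat.Uq (M.delete {e}) (p + 1) (q + 1))).card
  set sD1 := (shadowLev (M.delete {e}) (v + 1) (PerFlat.Uq (M.delete {e}) (p + 1) (q + 1))).card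
  set sC0 := (shadowLev (M.contract {e}) q (PerFlat.Uq (M.contract {e}) p q)).card
  set sC1 := (shadowLev (M.contract {e}) v (PerFlat.Uq (M.contract {e}) p q)).card
  -- the binomial comparison: `C(N, v+1)·C(N−2, q) ≤ C(N, q+1)·C(N−2, v)`
  have hbin : N.choose (v + 1) * (p + q).choose q ≤ N.choose (q + 1) * (p + q).choose v := by
    have := choose_mul_choose_le_choose_mul_choose (m := p + q) (a := q) (b := v) (by omega) (by omega)
    have e1 : N = p + q + 2 := by rw [hN]; ring
    rw [e1]; exact this
  -- the contraction part satisfies the `(p+1, q+1)` inequality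
  have hC' : sC0 * N.choose (v + 1) ≤ sC1 * N.choose (q + 1) := by
    have hpos : 0 < (p + q).choose q := Nat.choose_pos (by omega)
    apply Nat.le_of_mul_le_mul_left _ hpos
    calc (p + q).choose q * (sC0 * N.choose (v + 1))
        = sC0 * (N.choose (v + 1) * (p + q).choose q) := by ring
      _ ≤ sC0 * (N.choose (q + 1) * (p + q).choose v) := by gcongr
      _ = (sC0 * (p + q).choose v) * N.choose (q + 1) := by ring
      _ ≤ (sC1 * (p + q).choose q) * N.choose (q + 1) := by gcongr
      _ = (p + q).choose q * (sC1 * N.choose (q + 1)) := by ring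
  calc (sD0 + sC0) * N.choose (v + 1)
      = sD0 * N.choose (v + 1) + sC0 * N.choose (v + 1) := by ring
    _ ≤ sD1 * N.choose (q + 1) + sC1 * N.choose (q + 1) := Nat.add_le_add h1 hC'
    _ = (sD1 + sC1) * N.choose (q + 1) := by ring

end PercRepro.RankDist
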